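import Literature.MathematicalPhysics.QuantumFieldTheory.Balaban1983to89.B11Eq98V0LettersUniform

/-!
# `Balaban1983to89.B11Eq98V0LettersFlat` — T. Bałaban, *The variational problem and background fields in renormalization group method for
# lattice gauge theories*, Commun. Math. Phys. **102** (1985) 277–309 [Balaban1985Variational]: (90)–(96) pp. 291–292 (the V₀-group of `(δ/δA′)V`),
# (38) p. 284, (28) p. 282, (98) p. 293, and Sect. F p. 302 («all the operators in this section are taken without any external gauge field
# configuration (or alternatively with the configuration equal to 1)») — THE V₀-GROUP's (98)-SLOT WITH A LATTICE-UNIFORM CONSTANT: under print's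
# smallness (38)/(28) of the background plaquettes the constant depends on `d`, the level-geometry letter `Λ`, `‖ρ‖`, `‖τ‖` and the (38)-letter `K`
# ONLY, and `K = s + s²/2` follows from the CLASS letter (14) `‖U₀(∂q) − 1‖ ≤ sη²/w_∂(q)²`; at Sect. F's FLAT background `K = 0`; ONE level ⇒ `Λ = 1`

statement-level skeleton of published theorems with citation tags; proofs where landed; nothing here is a claim about the Yang–Mills mass gap

PDF held: `paper:balaban1985-cmp102-variational-background` (journal page = PDF page + 276); pp. 282, 284, 291–293, 302 read in the text layer.

THE PRINT.  p. 284 (38): *«|η⁻²(Re U₀(∂p) − 1)| < C₁B₃ε₁(Lʲη)⁻², p ∈ Ω_j, so the expression with Re U₀(∂p) − 1 has a hidden additional factor η²»*;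
p. 282 (28): the current `J` of the background is `O(C₁B₃ε₁(Lʲη)⁻²)` «by the assumption (14)»; p. 293 Prop. 4: *«|((δ/δA′)V)(A′)|₍₋₃₎ ≤
C₄(max{|A′|₍₋₁₎, |∇A′|₍₋₂₎})², (98) … The constants a₃, C₄ depend on d and L only.»*; p. 302 (Sect. F): *«Let us notice that all the operators
in this section are taken without any external gauge field configuration (or alternatively with the configuration equal to 1).»*

WHY THIS FILE (cells `pub-ymgap` ∕ `pub-balaban`, width seat `pub-ymgap-k0-s1-w2`, K0⁷ stub 1 `stub_prop8StepCoP13` = [15] Prop. 8 ∕ Sect. F one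
pass at NODE 00's objects; sub-target S4b «the (δ/δA′)V pieces»).  The V₀-group's (98)-slot `QuadAnalytic (curV0 ρ τ U₀) C_V (1/16)` is the `hqV`
input of the Sect. E∕F contraction (Prop. 6 for (111)/(158)).  The tree has it with the RIGHT structure but a PER-LATTICE constant:
`B11Eq63V0GroupCurrent.quadAnalytic_curV0` (ne9-leaf-05) displays the (38)-type trace slots `hRe1`/`hIm` with a letter `K`, and
`B11Eq98V0LettersUniform.exists_quadAnalytic_curV0_uniform` ∕ `B11Eq98V0LettersPerLattice` choose `K ∝ ‖τ‖·max_q w_∂(q)²/η²` by bounding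
`‖Re U₀(∂q) − 1‖ ≤ 2` — «a finite-lattice number, NOT print's «d and L only»; NO (38)∕(14) smallness».  THIS FILE supplies the two missing readings:
(i) under print's (38)/(28) smallness LETTERS of the background (`‖Re U₀(∂q) − 1‖ ≤ η²K/w_∂(q)²`, `‖η⁻²Im U₀(∂q)‖ ≤ K/w_∂(q)²`) and a contractive
trace, the slots hold with THAT `K` — so `C_V = 1024(d−1)Λ³‖ρ‖(K + 1/16) + (d−1)Λ³(136 + 2Λ)‖ρ‖‖τ‖` is uniform in the lattice; (ii) at the FLAT
background of Sect. F every plaquette variable is `1`, `Re 1 − 1 = 0`, `Im 1 = 0`, so `K = 0`; (iii) for ONE-LEVEL weights (constant level maps, the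
pure small-field ∕ top-cube reading «we assume that j = k», p. 300) the level-geometry letter is `Λ = 1`, giving the letter-free constant
`(d − 1)‖ρ‖(64 + 138‖τ‖)` at radius `1/16`.

WHAT IS PROVED (sorry-free; axioms standard; 0 `def`, no `Prop` placeholder, no new named fact; [15]'s inequalities are NOT asserted — the (38)/(28)
letters are hypotheses in §1, derived from the class letter (14) in §1b, and DISCHARGED (as `0`) at the flat background in §2).
* §1 `traceSlots38_of_contractive` — the slots `hRe1`, `hIm` of `quadAnalytic_curV0` from the (38)/(28) plaquette letters and `‖τ X‖ ≤ ‖X‖`;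
  **`quadAnalytic_curV0_of_plaq38`** — `QuadAnalytic (curV0 ρ τ U₀) C_V(d, Λ, ‖ρ‖, ‖τ‖, K) (1/16)` for every unitary unit-bounded background with the
  (38)/(28) letters, `Λ` displayed as in `quadAnalytic_curV0`.
* §1b `norm_reC_sub_one_le_sq` (`‖Re W − 1‖ ≤ ½‖W − 1‖²`, print's «hidden additional factor η²»), `norm_imC_le`, **`plaq38_of_class14`** — the
  (38)/(28) letters FROM the class letter (14)/(2) `‖U₀(∂q) − 1‖ ≤ s·η²/w_∂(q)²` with `K = s + s²/2`; **`quadAnalytic_curV0_of_class14`**.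
* §2 `plaqU_flat`, `reC_one_sub_one`, `imC_one`, `traceSlots38_flat` — at `U₀ = 1` the plaquette variables are `1` and the (38)/(28) letters hold with
  `K = 0`; **`quadAnalytic_curV0_flat`** — `QuadAnalytic (curV0 ρ τ 1) (64(d−1)Λ³‖ρ‖ + (d−1)Λ³(136 + 2Λ)‖ρ‖‖τ‖) (1/16)`, `Λ` displayed.
* §3 `levelGeometry_const` — for constant level maps the three level-geometry displays hold with `Λ = 1`; **`quadAnalytic_curV0_flat_oneLevel`** —
  `QuadAnalytic (curV0 ρ τ 1) ((d − 1)‖ρ‖(64 + 138‖τ‖)) (1/16)`, NO letter left but `ρ`, `τ` (tracial, `*`-compatible, contractive) and `1 ≤ L`.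
* §4 `curV0_flat_quadBound`, `curV0_flat_oneLevel_quadBound` — the consumer-ready pointwise forms `‖Y‖ < 1/16 → ‖curV0 ρ τ 1 Y‖ ≤ C·‖Y‖²`.

HONEST SCOPE — what is NOT claimed.  (i) This is the V₀-GROUP ONLY (W₄ + W₅ of Prop. 4 read at `A`): the groups (85)–(89) through `D`, `H`, `𝔇` and
the composition with the Sect. C map (47) are NOT touched (they are `B11Eq80Current.W80`'s other summands).  (ii) §1b's `s` is print's `C₁B₃ε₁` only
when a consumer supplies the class letter (14)/(2) of ITS background — nothing of [15]'s (14) itself is asserted.  (iii) `Λ` stays displayed in §1–§2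
(its uniform value on the cube sequence (144) is level-map geometry, not done here); §3 is the one-level case only.  (iv) NOT a discharge of N07 ∕
K0⁷; count-neutral; finite-lattice statements with lattice-uniform constants — NOT continuum ∕ OS ∕ mass gap ∕ Clay.
Imports `B11Eq98V0LettersUniform` ONLY (for `traceSlotsW_of_contractive`, `plaqU_mem_U1`); modifies nothing.
(v1.1 DOCFIX, k0-s1-w2 g2, ref-O g2 READ-27 NITs 1 ∕ 3: two docstrings re-worded — the (98)-constant's residual letters `Λ, ‖ρ‖, ‖τ‖` are the tree's, not
print's «d and L only»; the class letter is «(2) via (14)». Declarations and proofs byte-identical.)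
-/

noncomputable section

open scoped BigOperators
namespace Literature.MathematicalPhysics.QuantumFieldTheory.Balaban1983to89.B11Eq98V0LettersFlat

open Literature.MathematicalPhysics.QuantumFieldTheory.Balaban1983to89.B9Eq37Insertion (reC imC)
open Literature.MathematicalPhysics.QuantumFieldTheory.Balaban1983to89.B9Eq39Adjoint (posPlaq plaqU)
open Literature.MathematicalPhysics.QuantumFieldTheory.Balaban1983to89.B11Eq90StB (st)
open Literature.MathematicalPhysics.QuantumFieldTheory.Balaban1983to89.B11Eq90V0primeBond (plaqWeight plaqWeight_pos le_plaqWeight)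
open Literature.MathematicalPhysics.QuantumFieldTheory.Balaban1983to89.B11Eq90V0primeCurrent (Tsh Ucur)
open Literature.MathematicalPhysics.QuantumFieldTheory.Balaban1983to89.B11Eq63V0GroupCurrent (curV0 quadAnalytic_curV0)
open Literature.MathematicalPhysics.QuantumFieldTheory.Balaban1983to89.B11Eq98V0LettersUniform (traceSlotsW_of_contractive)
open Literature.MathematicalPhysics.QuantumFieldTheory.Balaban1983to89.B13Contraction113 (QuadAnalytic)
open B7Prop1Explicit (U1 mem_U1)
open B9SectCLatticeCarrier (Bond)
open B4Sect5Torus (TSite)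
open B11Eq115Space
open B11Eq111FrakG (nabla115)

variable {d : ℕ} {Pd : Fin d → ℕ} {L η : ℝ} [Fact (0 < L)] [Fact (0 < η)]
variable {𝔸 : Type*} [NormedRing 𝔸] [NormedAlgebra ℂ 𝔸]

/-! ## §1 The (38)/(28)-trace slots from the plaquette letters of the background and a contractive trace -/

omit [Fact (0 < L)] [Fact (0 < η)] in
/-- **THE (38)/(28) SLOTS OF `quadAnalytic_curV0` FROM THE PLAQUETTE LETTERS.**  If the background's plaquette variables satisfy print's (38)
`‖Re U₀(∂q) − 1‖ ≤ η²·K/w_∂(q)²` and the (28)-type `‖η⁻²Im U₀(∂q)‖ ≤ K/w_∂(q)²` on the positively oriented plaquettes, and the trace is contractive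
(`‖τ X‖ ≤ ‖X‖`), then `‖τ(Z·(Re U₀(∂q) − 1))‖ ≤ ‖Z‖·η²·K/w_∂(q)²` and `‖τ(Z·η⁻²Im U₀(∂q))‖ ≤ ‖Z‖·K/w_∂(q)²` — the slots `hRe1`, `hIm` with THE SAME `K`.
[cite: Balaban1985Variational, (38) p.284, (28) p.282, (90) p.291] -/
theorem traceSlots38_of_contractive (τ : 𝔸 →L[ℂ] ℂ) (hτ1 : ∀ X : 𝔸, ‖τ X‖ ≤ ‖X‖) (lev₀ : Bond d Pd → ℕ) {K : ℝ}
    {U₀ : Bond d Pd → 𝔸ˣ}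
    (h38re : ∀ q ∈ posPlaq (TSite d Pd) (Fin d),
      ‖reC (plaqU Tsh (Ucur U₀) q.2.1 q.2.2 q.1) - 1‖ ≤ η ^ 2 * (K / plaqWeight Tsh (levWeight L η lev₀ 1) q ^ 2))
    (h38im : ∀ q ∈ posPlaq (TSite d Pd) (Fin d),
      ‖((η : ℂ) ^ 2)⁻¹ • imC (plaqU Tsh (Ucur U₀) q.2.1 q.2.2 q.1)‖ ≤ K / plaqWeight Tsh (levWeight L η lev₀ 1) q ^ 2) :
    (∀ q ∈ posPlaq (TSite d Pd) (Fin d), ∀ Z : 𝔸,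
      ‖(τ : 𝔸 →ₗ[ℂ] ℂ) (Z * (reC (plaqU Tsh (Ucur U₀) q.2.1 q.2.2 q.1) - 1))‖
        ≤ ‖Z‖ * (η ^ 2 * (K / plaqWeight Tsh (levWeight L η lev₀ 1) q ^ 2))) ∧
    (∀ q ∈ posPlaq (TSite d Pd) (Fin d), ∀ Z : 𝔸,
      ‖(τ : 𝔸 →ₗ[ℂ] ℂ) (Z * (((η : ℂ) ^ 2)⁻¹ • imC (plaqU Tsh (Ucur U₀) q.2.1 q.2.2 q.1)))‖
        ≤ ‖Z‖ * (K / plaqWeight Tsh (levWeight L η lev₀ 1) q ^ 2)) := by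
  -- the generic estimate `‖τ(Z·X)‖ ≤ ‖Z‖·‖X‖` for a contractive `τ`
  have key : ∀ (Z X : 𝔸) (c : ℝ), ‖X‖ ≤ c → ‖(τ : 𝔸 →ₗ[ℂ] ℂ) (Z * X)‖ ≤ ‖Z‖ * c := fun Z X c hX => by
    calc ‖(τ : 𝔸 →ₗ[ℂ] ℂ) (Z * X)‖ = ‖τ (Z * X)‖ := rfl
      _ ≤ ‖Z * X‖ := hτ1 _
      _ ≤ ‖Z‖ * ‖X‖ := norm_mul_le _ _
      _ ≤ ‖Z‖ * c := mul_le_mul_of_nonneg_left hX (norm_nonneg _)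
  exact ⟨fun q hq Z => key Z _ _ (h38re q hq), fun q hq Z => key Z _ _ (h38im q hq)⟩

/-- **THE V₀-GROUP's (98)-SLOT UNDER PRINT's (38)/(28) SMALLNESS OF THE BACKGROUND, LATTICE-UNIFORM CONSTANT**: for a unitary unit-bounded
background `U₀` whose plaquette variables carry the (38)/(28) letters with constant `K ≥ 0`, a tracial `*`-compatible contractive trace `τ`, `1 ≤ L`
and the level-geometry letter `Λ` of `quadAnalytic_curV0`: `QuadAnalytic (curV0 ρ τ U₀) (1024(d−1)Λ³‖ρ‖(K + 1/16) + (d−1)Λ³(136 + 2Λ)‖ρ‖‖τ‖) (1/16)`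
— the constant reads `d, Λ, ‖ρ‖, ‖τ‖, K` only: NO lattice-size dependence is the FILE's gain; the residual letters `Λ`, `‖ρ‖`, `‖τ‖` are the tree's
(`quadAnalytic_curV0`'s), not print's — print (p. 293: «The constants a₃, C₄ depend on d and L only», with `K = C₁B₃ε₁`) absorbs them; this theorem does NOT
reach print's letter set (v1.1, ref-O g2 READ-27 NIT-1). [cite: Balaban1985Variational, (98) p.293, (38) p.284, (90)–(96) pp.291–292] -/
theorem quadAnalytic_curV0_of_plaq38 {lev₀ : Bond d Pd → ℕ} {lev₁ : Bond d Pd × Fin d → ℕ} [CompleteSpace 𝔸] [NormOneClass 𝔸] [StarRing 𝔸]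
    [StarModule ℂ 𝔸] (ρ : (𝔸 →L[ℂ] ℂ) →L[ℂ] 𝔸) (τ : 𝔸 →L[ℂ] ℂ)
    (hτ : ∀ a b : 𝔸, τ (a * b) = τ (b * a)) (hτs : ∀ a : 𝔸, τ (star a) = starRingEnd ℂ (τ a)) (hτ1 : ∀ X : 𝔸, ‖τ X‖ ≤ ‖X‖) (hL : 1 ≤ L)
    (U₀ : Bond d Pd → 𝔸ˣ) (hU : ∀ b, (((U₀ b)⁻¹ : 𝔸ˣ) : 𝔸) = star (U₀ b : 𝔸))
    (hUn : ∀ b, ‖(U₀ b : 𝔸)‖ ≤ 1 ∧ ‖(((U₀ b)⁻¹ : 𝔸ˣ) : 𝔸)‖ ≤ 1)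
    {K Λ : ℝ} (hK : 0 ≤ K) (hΛ1 : 1 ≤ Λ)
    (hΛ : ∀ q ∈ posPlaq (TSite d Pd) (Fin d), ∀ (μ₀ : Fin d) (x₀ : TSite d Pd), q ∈ st Tsh μ₀ x₀ →
      levWeight L η lev₀ 1 (x₀, μ₀) ≤ Λ * plaqWeight Tsh (levWeight L η lev₀ 1) q)
    (hΛa : ∀ (x₀ : TSite d Pd) (μ₀ ν : Fin d) (y : TSite d Pd), (y = x₀ ∨ y = (Tsh ν).symm x₀) →
      levWeight L η lev₀ 1 (x₀, μ₀) ≤ Λ * levWeight L η lev₀ 1 (y, μ₀) ∧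
        levWeight L η lev₀ 1 (x₀, μ₀) ≤ Λ * levWeight L η lev₀ 1 (y, ν))
    (hΛ' : ∀ (x₀ : TSite d Pd) (μ₀ ν : Fin d) (y : TSite d Pd), (y = x₀ ∨ y = (Tsh ν).symm x₀) →
      ∀ κ κ'' : Fin d, (κ = μ₀ ∨ κ = ν) → (κ'' = μ₀ ∨ κ'' = ν) →
        levWeight L η lev₀ 1 (x₀, μ₀) ^ 2 ≤ Λ ^ 2 * levWeight L η lev₁ 2 ((y, κ), κ''))
    (h38re : ∀ q ∈ posPlaq (TSite d Pd) (Fin d),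
      ‖reC (plaqU Tsh (Ucur U₀) q.2.1 q.2.2 q.1) - 1‖ ≤ η ^ 2 * (K / plaqWeight Tsh (levWeight L η lev₀ 1) q ^ 2))
    (h38im : ∀ q ∈ posPlaq (TSite d Pd) (Fin d),
      ‖((η : ℂ) ^ 2)⁻¹ • imC (plaqU Tsh (Ucur U₀) q.2.1 q.2.2 q.1)‖ ≤ K / plaqWeight Tsh (levWeight L η lev₀ 1) q ^ 2) :
    QuadAnalytic (curV0 (L := L) (η := η) (lev₀ := lev₀) (lev₁ := lev₁) (Dc := nabla115 η U₀) ρ τ U₀)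
      (1024 * ((d - 1 : ℕ) : ℝ) * Λ ^ 3 * ‖ρ‖ * (K + 1 / 16)
        + ((d - 1 : ℕ) : ℝ) * Λ ^ 3 * (136 + 2 * Λ) * ‖ρ‖ * ‖τ‖) (1 / 16) := by
  obtain ⟨hRe1, hIm⟩ := traceSlots38_of_contractive (L := L) (η := η) τ hτ1 lev₀ h38re h38im
  obtain ⟨hW, hW'⟩ := traceSlotsW_of_contractive (d := d) (Pd := Pd) τ hτ1 hUn
  exact quadAnalytic_curV0 ρ τ U₀ hU hUn hτ hτs hL hK hΛ1 hΛ hΛa hΛ' hRe1 hIm hW hW'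

/-! ## §1b The (38)/(28) letters FROM the class letter (14)/(2) of the background («a hidden additional factor η²») -/

section Class14

variable [NormOneClass 𝔸]

omit [NormedAlgebra ℂ 𝔸] [NormOneClass 𝔸] in
/-- `‖W⁻¹ − 1‖ ≤ ‖W − 1‖` for a unit with `‖W⁻¹‖ ≤ 1` (`W⁻¹ − 1 = W⁻¹(1 − W)`). [folklore] [cite: Balaban1985Variational, (38) p.284] -/
theorem norm_inv_sub_one_le (W : 𝔸ˣ) (hWi : ‖((W⁻¹ : 𝔸ˣ) : 𝔸)‖ ≤ 1) : ‖((W⁻¹ : 𝔸ˣ) : 𝔸) - 1‖ ≤ ‖(W : 𝔸) - 1‖ := by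
  have h : ((W⁻¹ : 𝔸ˣ) : 𝔸) - 1 = ((W⁻¹ : 𝔸ˣ) : 𝔸) * (1 - (W : 𝔸)) := by rw [mul_sub, mul_one, Units.inv_mul]
  rw [h]
  calc ‖((W⁻¹ : 𝔸ˣ) : 𝔸) * (1 - (W : 𝔸))‖ ≤ ‖((W⁻¹ : 𝔸ˣ) : 𝔸)‖ * ‖1 - (W : 𝔸)‖ := norm_mul_le _ _
    _ ≤ 1 * ‖1 - (W : 𝔸)‖ := mul_le_mul_of_nonneg_right hWi (norm_nonneg _)
    _ = ‖(W : 𝔸) - 1‖ := by rw [one_mul, norm_sub_rev]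

omit [NormOneClass 𝔸] in
/-- **«THE EXPRESSION WITH `Re U₀(∂p) − 1` HAS A HIDDEN ADDITIONAL FACTOR η²»** (p. 284 under (38)): `Re W − 1 = −½(W − 1)(W⁻¹ − 1)`, hence
`‖Re W − 1‖ ≤ ½‖W − 1‖²` for a unit with `‖W⁻¹‖ ≤ 1` — SECOND order in the plaquette deviation. [cite: Balaban1985Variational, (38) p.284] -/
theorem norm_reC_sub_one_le_sq (W : 𝔸ˣ) (hWi : ‖((W⁻¹ : 𝔸ˣ) : 𝔸)‖ ≤ 1) : ‖reC W - 1‖ ≤ 2⁻¹ * ‖(W : 𝔸) - 1‖ ^ 2 := by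
  have hmul : (W : 𝔸) * ((W⁻¹ : 𝔸ˣ) : 𝔸) = 1 := Units.mul_inv W
  have e : (2 : ℂ) • (reC W - 1) = -(((W : 𝔸) - 1) * (((W⁻¹ : 𝔸ˣ) : 𝔸) - 1)) := by
    calc (2 : ℂ) • (reC W - 1) = ((W : 𝔸) + ((W⁻¹ : 𝔸ˣ) : 𝔸)) - ((1 : 𝔸) + 1) := by
          rw [smul_sub, reC, smul_smul, mul_inv_cancel₀ two_ne_zero, one_smul, two_smul]
      _ = -(((W : 𝔸) - 1) * (((W⁻¹ : 𝔸ˣ) : 𝔸) - 1)) := by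
          simp only [sub_mul, mul_sub, one_mul, mul_one, hmul]; abel
  have hn : ‖(2 : ℂ) • (reC W - 1)‖ ≤ ‖(W : 𝔸) - 1‖ ^ 2 := by
    rw [e, norm_neg]
    calc ‖((W : 𝔸) - 1) * (((W⁻¹ : 𝔸ˣ) : 𝔸) - 1)‖ ≤ ‖(W : 𝔸) - 1‖ * ‖((W⁻¹ : 𝔸ˣ) : 𝔸) - 1‖ := norm_mul_le _ _
      _ ≤ ‖(W : 𝔸) - 1‖ * ‖(W : 𝔸) - 1‖ := mul_le_mul_of_nonneg_left (norm_inv_sub_one_le W hWi) (norm_nonneg _)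
      _ = ‖(W : 𝔸) - 1‖ ^ 2 := (sq _).symm
  rw [norm_smul, Complex.norm_two] at hn
  linarith

omit [NormOneClass 𝔸] in
/-- `‖Im W‖ ≤ ‖W − 1‖` for a unit with `‖W⁻¹‖ ≤ 1` (`Im W = (2i)⁻¹((W − 1) − (W⁻¹ − 1))`). [folklore] [cite: Balaban1985Variational, (27)–(28) p.282] -/
theorem norm_imC_le (W : 𝔸ˣ) (hWi : ‖((W⁻¹ : 𝔸ˣ) : 𝔸)‖ ≤ 1) : ‖imC W‖ ≤ ‖(W : 𝔸) - 1‖ := by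
  have e : imC W = (2 * Complex.I)⁻¹ • (((W : 𝔸) - 1) - (((W⁻¹ : 𝔸ˣ) : 𝔸) - 1)) := by
    unfold imC; congr 1; abel
  rw [e, norm_smul, norm_inv, norm_mul, Complex.norm_two, Complex.norm_I, mul_one]
  calc 2⁻¹ * ‖((W : 𝔸) - 1) - (((W⁻¹ : 𝔸ˣ) : 𝔸) - 1)‖ ≤ 2⁻¹ * (‖(W : 𝔸) - 1‖ + ‖((W⁻¹ : 𝔸ˣ) : 𝔸) - 1‖) :=
        mul_le_mul_of_nonneg_left (norm_sub_le _ _) (by norm_num)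
    _ ≤ 2⁻¹ * (‖(W : 𝔸) - 1‖ + ‖(W : 𝔸) - 1‖) := by gcongr; exact norm_inv_sub_one_le W hWi
    _ = ‖(W : 𝔸) - 1‖ := by ring

/-- **(14)/(2) ⇒ (38)/(28): THE TRACE-SLOT LETTERS FROM THE CLASS LETTER OF THE BACKGROUND, UNIFORMLY.**  If the background is unit-bounded and its
plaquette variables satisfy the class bound `‖U₀(∂q) − 1‖ ≤ s·η²/w_∂(q)²` (the plaquette bound of the class definition (2) p. 278, which print's (14) p. 280
asserts for the background as the membership `U₀ ∈ U_k({Ω_j}, C₁B₃ε₁)` — «(2) via (14)»: `|U₀(∂p) − 1| < C₁B₃ε₁L^{−2j}`, `η²/(Lʲη)² = L^{−2j}`; v1.1, ref-O g2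
READ-27 NIT-3), with
`0 ≤ s`, `1 ≤ L`, then the (38)-letter holds with `η²·(s²/2)/w_∂(q)²` («hidden factor η²»: `‖Re W − 1‖ ≤ ½‖W − 1‖²` and `η ≤ w_∂(q)`) and the (28)-letter
with `s/w_∂(q)²`; both with `K = s + s²/2`. [cite: Balaban1985Variational, (14) p.280, (38) p.284, (28) p.282] -/
theorem plaq38_of_class14 (lev₀ : Bond d Pd → ℕ) (hL : 1 ≤ L) {s : ℝ} (hs : 0 ≤ s) {U₀ : Bond d Pd → 𝔸ˣ}
    (hUn : ∀ b, ‖(U₀ b : 𝔸)‖ ≤ 1 ∧ ‖(((U₀ b)⁻¹ : 𝔸ˣ) : 𝔸)‖ ≤ 1)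
    (h14 : ∀ q ∈ posPlaq (TSite d Pd) (Fin d),
      ‖(plaqU Tsh (Ucur U₀) q.2.1 q.2.2 q.1 : 𝔸) - 1‖ ≤ s * (η ^ 2 / plaqWeight Tsh (levWeight L η lev₀ 1) q ^ 2)) :
    (∀ q ∈ posPlaq (TSite d Pd) (Fin d),
      ‖reC (plaqU Tsh (Ucur U₀) q.2.1 q.2.2 q.1) - 1‖ ≤ η ^ 2 * ((s + s ^ 2 / 2) / plaqWeight Tsh (levWeight L η lev₀ 1) q ^ 2)) ∧
    (∀ q ∈ posPlaq (TSite d Pd) (Fin d),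
      ‖((η : ℂ) ^ 2)⁻¹ • imC (plaqU Tsh (Ucur U₀) q.2.1 q.2.2 q.1)‖ ≤ (s + s ^ 2 / 2) / plaqWeight Tsh (levWeight L η lev₀ 1) q ^ 2) := by
  have hη : (0 : ℝ) < η := Fact.out
  have hL0 : (0 : ℝ) < L := Fact.out
  have hwη : ∀ b : Bond d Pd, η ≤ levWeight L η lev₀ 1 b := fun b => by
    rw [levWeight_apply, pow_one]
    exact le_mul_of_one_le_left hη.le (one_le_pow₀ hL)
  have hpw : ∀ q, 0 < plaqWeight Tsh (levWeight L η lev₀ 1) q := plaqWeight_pos Tsh (levWeight_pos hL0 hη lev₀ 1)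
  have hηw : ∀ q, η ≤ plaqWeight Tsh (levWeight L η lev₀ 1) q := le_plaqWeight Tsh hwη
  have hmem : ∀ q : TSite d Pd × Fin d × Fin d, ‖(((plaqU Tsh (Ucur U₀) q.2.1 q.2.2 q.1)⁻¹ : 𝔸ˣ) : 𝔸)‖ ≤ 1 := fun q =>
    (mem_U1.1 (B11Eq98V0LettersUniform.plaqU_mem_U1 (fun b => mem_U1.2 (hUn b)) q.2.1 q.2.2 q.1)).2
  refine ⟨fun q hq => ?_, fun q hq => ?_⟩
  · set w := plaqWeight Tsh (levWeight L η lev₀ 1) q with hw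
    have hw0 : 0 < w := hpw q
    have hratio : η ^ 2 / w ^ 2 ≤ 1 := by
      rw [div_le_one (by positivity)]; exact pow_le_pow_left₀ hη.le (hηw q) 2
    calc ‖reC (plaqU Tsh (Ucur U₀) q.2.1 q.2.2 q.1) - 1‖
        ≤ 2⁻¹ * ‖(plaqU Tsh (Ucur U₀) q.2.1 q.2.2 q.1 : 𝔸) - 1‖ ^ 2 := norm_reC_sub_one_le_sq _ (hmem q)
      _ ≤ 2⁻¹ * (s * (η ^ 2 / w ^ 2)) ^ 2 := by gcongr; exact h14 q hq
      _ = η ^ 2 * ((s ^ 2 / 2) / w ^ 2) * (η ^ 2 / w ^ 2) := by ring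
      _ ≤ η ^ 2 * ((s ^ 2 / 2) / w ^ 2) * 1 := mul_le_mul_of_nonneg_left hratio (by positivity)
      _ ≤ η ^ 2 * ((s + s ^ 2 / 2) / w ^ 2) := by
          rw [mul_one]; gcongr; linarith
  · set w := plaqWeight Tsh (levWeight L η lev₀ 1) q with hw
    have hw0 : 0 < w := hpw q
    have hηC : ‖((η : ℂ) ^ 2)⁻¹‖ = (η ^ 2)⁻¹ := by
      rw [norm_inv, norm_pow, Complex.norm_real, Real.norm_of_nonneg hη.le]
    rw [norm_smul, hηC]
    calc (η ^ 2)⁻¹ * ‖imC (plaqU Tsh (Ucur U₀) q.2.1 q.2.2 q.1)‖ ≤ (η ^ 2)⁻¹ * ‖(plaqU Tsh (Ucur U₀) q.2.1 q.2.2 q.1 : 𝔸) - 1‖ :=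
          mul_le_mul_of_nonneg_left (norm_imC_le _ (hmem q)) (by positivity)
      _ ≤ (η ^ 2)⁻¹ * (s * (η ^ 2 / w ^ 2)) := mul_le_mul_of_nonneg_left (h14 q hq) (by positivity)
      _ = s / w ^ 2 := by field_simp
      _ ≤ (s + s ^ 2 / 2) / w ^ 2 := by gcongr; nlinarith

/-- **THE V₀-GROUP's (98)-SLOT FROM THE CLASS LETTER (14)/(2) OF THE BACKGROUND, LATTICE-UNIFORM CONSTANT**: for a unitary unit-bounded background
whose plaquette variables satisfy `‖U₀(∂q) − 1‖ ≤ s·η²/w_∂(q)²` (print: `s = C₁B₃ε₁`), a tracial `*`-compatible contractive trace, `1 ≤ L` and the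
level-geometry letter `Λ`: `QuadAnalytic (curV0 ρ τ U₀) (1024(d−1)Λ³‖ρ‖(s + s²/2 + 1/16) + (d−1)Λ³(136 + 2Λ)‖ρ‖‖τ‖) (1/16)`.
[cite: Balaban1985Variational, (98) p.293, (14) p.280, (38) p.284, (90)–(96) pp.291–292] -/
theorem quadAnalytic_curV0_of_class14 {lev₀ : Bond d Pd → ℕ} {lev₁ : Bond d Pd × Fin d → ℕ} [CompleteSpace 𝔸] [StarRing 𝔸]
    [StarModule ℂ 𝔸] (ρ : (𝔸 →L[ℂ] ℂ) →L[ℂ] 𝔸) (τ : 𝔸 →L[ℂ] ℂ)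
    (hτ : ∀ a b : 𝔸, τ (a * b) = τ (b * a)) (hτs : ∀ a : 𝔸, τ (star a) = starRingEnd ℂ (τ a)) (hτ1 : ∀ X : 𝔸, ‖τ X‖ ≤ ‖X‖) (hL : 1 ≤ L)
    (U₀ : Bond d Pd → 𝔸ˣ) (hU : ∀ b, (((U₀ b)⁻¹ : 𝔸ˣ) : 𝔸) = star (U₀ b : 𝔸))
    (hUn : ∀ b, ‖(U₀ b : 𝔸)‖ ≤ 1 ∧ ‖(((U₀ b)⁻¹ : 𝔸ˣ) : 𝔸)‖ ≤ 1)
    {s Λ : ℝ} (hs : 0 ≤ s) (hΛ1 : 1 ≤ Λ)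
    (hΛ : ∀ q ∈ posPlaq (TSite d Pd) (Fin d), ∀ (μ₀ : Fin d) (x₀ : TSite d Pd), q ∈ st Tsh μ₀ x₀ →
      levWeight L η lev₀ 1 (x₀, μ₀) ≤ Λ * plaqWeight Tsh (levWeight L η lev₀ 1) q)
    (hΛa : ∀ (x₀ : TSite d Pd) (μ₀ ν : Fin d) (y : TSite d Pd), (y = x₀ ∨ y = (Tsh ν).symm x₀) →
      levWeight L η lev₀ 1 (x₀, μ₀) ≤ Λ * levWeight L η lev₀ 1 (y, μ₀) ∧
        levWeight L η lev₀ 1 (x₀, μ₀) ≤ Λ * levWeight L η lev₀ 1 (y, ν))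
    (hΛ' : ∀ (x₀ : TSite d Pd) (μ₀ ν : Fin d) (y : TSite d Pd), (y = x₀ ∨ y = (Tsh ν).symm x₀) →
      ∀ κ κ'' : Fin d, (κ = μ₀ ∨ κ = ν) → (κ'' = μ₀ ∨ κ'' = ν) →
        levWeight L η lev₀ 1 (x₀, μ₀) ^ 2 ≤ Λ ^ 2 * levWeight L η lev₁ 2 ((y, κ), κ''))
    (h14 : ∀ q ∈ posPlaq (TSite d Pd) (Fin d),
      ‖(plaqU Tsh (Ucur U₀) q.2.1 q.2.2 q.1 : 𝔸) - 1‖ ≤ s * (η ^ 2 / plaqWeight Tsh (levWeight L η lev₀ 1) q ^ 2)) :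
    QuadAnalytic (curV0 (L := L) (η := η) (lev₀ := lev₀) (lev₁ := lev₁) (Dc := nabla115 η U₀) ρ τ U₀)
      (1024 * ((d - 1 : ℕ) : ℝ) * Λ ^ 3 * ‖ρ‖ * ((s + s ^ 2 / 2) + 1 / 16)
        + ((d - 1 : ℕ) : ℝ) * Λ ^ 3 * (136 + 2 * Λ) * ‖ρ‖ * ‖τ‖) (1 / 16) := by
  obtain ⟨h38re, h38im⟩ := plaq38_of_class14 (L := L) (η := η) lev₀ hL hs hUn h14
  exact quadAnalytic_curV0_of_plaq38 (lev₁ := lev₁) ρ τ hτ hτs hτ1 hL U₀ hU hUn (by positivity) hΛ1 hΛ hΛa hΛ' h38re h38im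

end Class14

/-! ## §2 The flat background of Sect. F: every plaquette variable is `1`, the (38)/(28) letters are `K = 0` -/

section Flat

variable [NormOneClass 𝔸]

omit [NormedAlgebra ℂ 𝔸] [NormOneClass 𝔸] in
/-- At the flat background `U₀ = 1` every plaquette variable `U₀(∂q) = 1·1·1⁻¹·1⁻¹` is `1`. [cite: Balaban1985Variational, p.302 (Sect. F, «configuration equal to 1»)] -/
theorem plaqU_flat (μ ν : Fin d) (x : TSite d Pd) : plaqU Tsh (Ucur (1 : Bond d Pd → 𝔸ˣ)) μ ν x = 1 := by
  simp [plaqU, Ucur]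

omit [NormOneClass 𝔸] in
/-- `Re 1 − 1 = 0` (`Re W = ½(W + W⁻¹)`). [folklore] [cite: Balaban1985Variational, (38) p.284] -/
theorem reC_one_sub_one : reC (1 : 𝔸ˣ) - 1 = (0 : 𝔸) := by
  have h : reC (1 : 𝔸ˣ) = (1 : 𝔸) := by
    unfold reC
    rw [Units.val_one, inv_one, Units.val_one, ← two_smul ℂ (1 : 𝔸), smul_smul, inv_mul_cancel₀ two_ne_zero, one_smul]
  rw [h, sub_self]

omit [NormOneClass 𝔸] in
/-- `Im 1 = 0` (`Im W = (2i)⁻¹(W − W⁻¹)`). [folklore] [cite: Balaban1985Variational, (27)–(28) p.282] -/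
theorem imC_one : imC (1 : 𝔸ˣ) = (0 : 𝔸) := by
  unfold imC
  rw [Units.val_one, inv_one, Units.val_one, sub_self, smul_zero]

omit [Fact (0 < L)] [Fact (0 < η)] [NormOneClass 𝔸] in
/-- **AT THE FLAT BACKGROUND THE (38)/(28) LETTERS HOLD WITH `K = 0`**: `‖Re 1(∂q) − 1‖ = 0 ≤ η²·0/w_∂(q)²`, `‖η⁻²Im 1(∂q)‖ = 0 ≤ 0/w_∂(q)²`.
[cite: Balaban1985Variational, (38) p.284, p.302] -/
theorem traceSlots38_flat (lev₀ : Bond d Pd → ℕ) :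
    (∀ q ∈ posPlaq (TSite d Pd) (Fin d),
      ‖reC (plaqU Tsh (Ucur (1 : Bond d Pd → 𝔸ˣ)) q.2.1 q.2.2 q.1) - 1‖ ≤ η ^ 2 * (0 / plaqWeight Tsh (levWeight L η lev₀ 1) q ^ 2)) ∧
    (∀ q ∈ posPlaq (TSite d Pd) (Fin d),
      ‖((η : ℂ) ^ 2)⁻¹ • imC (plaqU Tsh (Ucur (1 : Bond d Pd → 𝔸ˣ)) q.2.1 q.2.2 q.1)‖ ≤ 0 / plaqWeight Tsh (levWeight L η lev₀ 1) q ^ 2) := by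
  refine ⟨fun q _ => ?_, fun q _ => ?_⟩
  · rw [plaqU_flat, reC_one_sub_one, norm_zero, zero_div, mul_zero]
  · rw [plaqU_flat, imC_one, smul_zero, norm_zero, zero_div]

omit [NormedAlgebra ℂ 𝔸] in
/-- The flat background is unitary and unit-bounded in the sense of `quadAnalytic_curV0` (`1⁻¹ = 1 = 1*`, `‖1‖ = 1`). [folklore]
[cite: Balaban1985Variational, p.302] -/
theorem flat_unitary_unitBounded [StarRing 𝔸] :
    (∀ b : Bond d Pd, ((((1 : Bond d Pd → 𝔸ˣ) b)⁻¹ : 𝔸ˣ) : 𝔸) = star (((1 : Bond d Pd → 𝔸ˣ) b : 𝔸ˣ) : 𝔸)) ∧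
    (∀ b : Bond d Pd, ‖(((1 : Bond d Pd → 𝔸ˣ) b : 𝔸ˣ) : 𝔸)‖ ≤ 1 ∧ ‖((((1 : Bond d Pd → 𝔸ˣ) b)⁻¹ : 𝔸ˣ) : 𝔸)‖ ≤ 1) := by
  refine ⟨fun b => ?_, fun b => ?_⟩
  · rw [Pi.one_apply, inv_one, Units.val_one, star_one]
  · rw [Pi.one_apply, inv_one, Units.val_one, norm_one]
    exact ⟨le_rfl, le_rfl⟩

/-- **THE V₀-GROUP's (98)-SLOT AT THE FLAT BACKGROUND OF SECT. F, LATTICE-UNIFORM**: for a tracial `*`-compatible contractive trace `τ`, `1 ≤ L` and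
the level-geometry letter `Λ` (displayed as in `quadAnalytic_curV0`):
`QuadAnalytic (curV0 ρ τ 1) (64(d−1)Λ³‖ρ‖ + (d−1)Λ³(136 + 2Λ)‖ρ‖‖τ‖) (1/16)` — the (38)/(28) letter is `K = 0` (§2), nothing of the lattice size enters.
[cite: Balaban1985Variational, (98) p.293, (90)–(96) pp.291–292, p.302] -/
theorem quadAnalytic_curV0_flat {lev₀ : Bond d Pd → ℕ} {lev₁ : Bond d Pd × Fin d → ℕ} [CompleteSpace 𝔸] [StarRing 𝔸] [StarModule ℂ 𝔸]
    (ρ : (𝔸 →L[ℂ] ℂ) →L[ℂ] 𝔸) (τ : 𝔸 →L[ℂ] ℂ)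
    (hτ : ∀ a b : 𝔸, τ (a * b) = τ (b * a)) (hτs : ∀ a : 𝔸, τ (star a) = starRingEnd ℂ (τ a)) (hτ1 : ∀ X : 𝔸, ‖τ X‖ ≤ ‖X‖) (hL : 1 ≤ L)
    {Λ : ℝ} (hΛ1 : 1 ≤ Λ)
    (hΛ : ∀ q ∈ posPlaq (TSite d Pd) (Fin d), ∀ (μ₀ : Fin d) (x₀ : TSite d Pd), q ∈ st Tsh μ₀ x₀ →
      levWeight L η lev₀ 1 (x₀, μ₀) ≤ Λ * plaqWeight Tsh (levWeight L η lev₀ 1) q)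
    (hΛa : ∀ (x₀ : TSite d Pd) (μ₀ ν : Fin d) (y : TSite d Pd), (y = x₀ ∨ y = (Tsh ν).symm x₀) →
      levWeight L η lev₀ 1 (x₀, μ₀) ≤ Λ * levWeight L η lev₀ 1 (y, μ₀) ∧
        levWeight L η lev₀ 1 (x₀, μ₀) ≤ Λ * levWeight L η lev₀ 1 (y, ν))
    (hΛ' : ∀ (x₀ : TSite d Pd) (μ₀ ν : Fin d) (y : TSite d Pd), (y = x₀ ∨ y = (Tsh ν).symm x₀) →
      ∀ κ κ'' : Fin d, (κ = μ₀ ∨ κ = ν) → (κ'' = μ₀ ∨ κ'' = ν) →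
        levWeight L η lev₀ 1 (x₀, μ₀) ^ 2 ≤ Λ ^ 2 * levWeight L η lev₁ 2 ((y, κ), κ'')) :
    QuadAnalytic (curV0 (L := L) (η := η) (lev₀ := lev₀) (lev₁ := lev₁) (Dc := nabla115 η (1 : Bond d Pd → 𝔸ˣ)) ρ τ 1)
      (64 * ((d - 1 : ℕ) : ℝ) * Λ ^ 3 * ‖ρ‖ + ((d - 1 : ℕ) : ℝ) * Λ ^ 3 * (136 + 2 * Λ) * ‖ρ‖ * ‖τ‖) (1 / 16) := by
  obtain ⟨h38re, h38im⟩ := traceSlots38_flat (𝔸 := 𝔸) (L := L) (η := η) lev₀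
  obtain ⟨hU, hUn⟩ := flat_unitary_unitBounded (𝔸 := 𝔸) (d := d) (Pd := Pd)
  have h := quadAnalytic_curV0_of_plaq38 (lev₁ := lev₁) ρ τ hτ hτs hτ1 hL 1 hU hUn le_rfl hΛ1 hΛ hΛa hΛ' h38re h38im
  have hc : 1024 * ((d - 1 : ℕ) : ℝ) * Λ ^ 3 * ‖ρ‖ * (0 + 1 / 16) + ((d - 1 : ℕ) : ℝ) * Λ ^ 3 * (136 + 2 * Λ) * ‖ρ‖ * ‖τ‖
      = 64 * ((d - 1 : ℕ) : ℝ) * Λ ^ 3 * ‖ρ‖ + ((d - 1 : ℕ) : ℝ) * Λ ^ 3 * (136 + 2 * Λ) * ‖ρ‖ * ‖τ‖ := by ring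
  rw [hc] at h
  exact h

end Flat

/-! ## §3 One-level weights: the level-geometry letter is `Λ = 1` -/

omit [Fact (0 < L)] [Fact (0 < η)] in
/-- **FOR CONSTANT LEVEL MAPS THE THREE LEVEL-GEOMETRY DISPLAYS OF `quadAnalytic_curV0` HOLD WITH `Λ = 1`**: all bond weights equal `Lʲη`, the
plaquette weight (a minimum of four equal weights) equals `Lʲη`, and the pair weight is `(Lʲη)²` (the pure small-field ∕ top-cube reading with one
radius, p. 300 «we assume that j = k»). [cite: Balaban1985Variational, p.286, p.300, (115) p.294] -/
theorem levelGeometry_const (j : ℕ) :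
    (∀ q ∈ posPlaq (TSite d Pd) (Fin d), ∀ (μ₀ : Fin d) (x₀ : TSite d Pd), q ∈ st Tsh μ₀ x₀ →
      levWeight L η (fun _ : Bond d Pd => j) 1 (x₀, μ₀) ≤ 1 * plaqWeight Tsh (levWeight L η (fun _ : Bond d Pd => j) 1) q) ∧
    (∀ (x₀ : TSite d Pd) (μ₀ ν : Fin d) (y : TSite d Pd), (y = x₀ ∨ y = (Tsh ν).symm x₀) →
      levWeight L η (fun _ : Bond d Pd => j) 1 (x₀, μ₀) ≤ 1 * levWeight L η (fun _ : Bond d Pd => j) 1 (y, μ₀) ∧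
        levWeight L η (fun _ : Bond d Pd => j) 1 (x₀, μ₀) ≤ 1 * levWeight L η (fun _ : Bond d Pd => j) 1 (y, ν)) ∧
    (∀ (x₀ : TSite d Pd) (μ₀ ν : Fin d) (y : TSite d Pd), (y = x₀ ∨ y = (Tsh ν).symm x₀) →
      ∀ κ κ'' : Fin d, (κ = μ₀ ∨ κ = ν) → (κ'' = μ₀ ∨ κ'' = ν) →
        levWeight L η (fun _ : Bond d Pd => j) 1 (x₀, μ₀) ^ 2 ≤ (1 : ℝ) ^ 2 * levWeight L η (fun _ : Bond d Pd × Fin d => j) 2 ((y, κ), κ'')) := by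
  refine ⟨fun q _ μ₀ x₀ _ => ?_, fun x₀ μ₀ ν y _ => ?_, fun x₀ μ₀ ν y _ κ κ'' _ _ => ?_⟩
  · simp only [levWeight, plaqWeight, pow_one, min_self, one_mul, le_refl]
  · simp only [levWeight, one_mul, le_refl, and_self]
  · simp only [levWeight, pow_one, one_pow, one_mul, le_refl]

/-- **THE V₀-GROUP's (98)-SLOT AT THE FLAT BACKGROUND, ONE LEVEL, NO LETTER LEFT**: for constant level maps `j` (weights `Lʲη`, `(Lʲη)²`,
`(Lʲη)³`), a tracial `*`-compatible contractive trace `τ` and `1 ≤ L`: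
`QuadAnalytic (curV0 ρ τ 1) ((d − 1)‖ρ‖(64 + 138‖τ‖)) (1/16)` — uniform in the lattice, in `j`, in `η` and in `L`.
[cite: Balaban1985Variational, (98) p.293, Prop. 4 p.293 («depend on d and L only»), p.302] -/
theorem quadAnalytic_curV0_flat_oneLevel [CompleteSpace 𝔸] [NormOneClass 𝔸] [StarRing 𝔸] [StarModule ℂ 𝔸]
    (ρ : (𝔸 →L[ℂ] ℂ) →L[ℂ] 𝔸) (τ : 𝔸 →L[ℂ] ℂ)
    (hτ : ∀ a b : 𝔸, τ (a * b) = τ (b * a)) (hτs : ∀ a : 𝔸, τ (star a) = starRingEnd ℂ (τ a)) (hτ1 : ∀ X : 𝔸, ‖τ X‖ ≤ ‖X‖) (hL : 1 ≤ L)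
    (j : ℕ) :
    QuadAnalytic (curV0 (L := L) (η := η) (lev₀ := fun _ : Bond d Pd => j) (lev₁ := fun _ : Bond d Pd × Fin d => j)
        (Dc := nabla115 η (1 : Bond d Pd → 𝔸ˣ)) ρ τ 1)
      (((d - 1 : ℕ) : ℝ) * ‖ρ‖ * (64 + 138 * ‖τ‖)) (1 / 16) := by
  obtain ⟨hΛ, hΛa, hΛ'⟩ := levelGeometry_const (d := d) (Pd := Pd) (L := L) (η := η) j
  have h := quadAnalytic_curV0_flat (lev₀ := fun _ : Bond d Pd => j) (lev₁ := fun _ : Bond d Pd × Fin d => j) ρ τ hτ hτs hτ1 hL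
    (Λ := 1) le_rfl hΛ hΛa hΛ'
  have hc : 64 * ((d - 1 : ℕ) : ℝ) * (1 : ℝ) ^ 3 * ‖ρ‖ + ((d - 1 : ℕ) : ℝ) * (1 : ℝ) ^ 3 * (136 + 2 * 1) * ‖ρ‖ * ‖τ‖
      = ((d - 1 : ℕ) : ℝ) * ‖ρ‖ * (64 + 138 * ‖τ‖) := by ring
  rw [hc] at h
  exact h

/-! ## §4 Consumer-ready pointwise forms (the `hqV` face at `(C_V, 1/16)`) -/

/-- **`‖Y‖ < 1/16 → ‖curV0 ρ τ 1 Y‖₍₋₃₎ ≤ C_V·‖Y‖²` AT THE FLAT BACKGROUND**, `C_V = 64(d−1)Λ³‖ρ‖ + (d−1)Λ³(136 + 2Λ)‖ρ‖‖τ‖` with the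
level-geometry letter `Λ` displayed (the `quad` field of `quadAnalytic_curV0_flat`). [cite: Balaban1985Variational, (98) p.293, p.302] -/
theorem curV0_flat_quadBound {lev₀ : Bond d Pd → ℕ} {lev₁ : Bond d Pd × Fin d → ℕ} [CompleteSpace 𝔸] [NormOneClass 𝔸] [StarRing 𝔸]
    [StarModule ℂ 𝔸] (ρ : (𝔸 →L[ℂ] ℂ) →L[ℂ] 𝔸) (τ : 𝔸 →L[ℂ] ℂ)
    (hτ : ∀ a b : 𝔸, τ (a * b) = τ (b * a)) (hτs : ∀ a : 𝔸, τ (star a) = starRingEnd ℂ (τ a)) (hτ1 : ∀ X : 𝔸, ‖τ X‖ ≤ ‖X‖) (hL : 1 ≤ L)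
    {Λ : ℝ} (hΛ1 : 1 ≤ Λ)
    (hΛ : ∀ q ∈ posPlaq (TSite d Pd) (Fin d), ∀ (μ₀ : Fin d) (x₀ : TSite d Pd), q ∈ st Tsh μ₀ x₀ →
      levWeight L η lev₀ 1 (x₀, μ₀) ≤ Λ * plaqWeight Tsh (levWeight L η lev₀ 1) q)
    (hΛa : ∀ (x₀ : TSite d Pd) (μ₀ ν : Fin d) (y : TSite d Pd), (y = x₀ ∨ y = (Tsh ν).symm x₀) →
      levWeight L η lev₀ 1 (x₀, μ₀) ≤ Λ * levWeight L η lev₀ 1 (y, μ₀) ∧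
        levWeight L η lev₀ 1 (x₀, μ₀) ≤ Λ * levWeight L η lev₀ 1 (y, ν))
    (hΛ' : ∀ (x₀ : TSite d Pd) (μ₀ ν : Fin d) (y : TSite d Pd), (y = x₀ ∨ y = (Tsh ν).symm x₀) →
      ∀ κ κ'' : Fin d, (κ = μ₀ ∨ κ = ν) → (κ'' = μ₀ ∨ κ'' = ν) →
        levWeight L η lev₀ 1 (x₀, μ₀) ^ 2 ≤ Λ ^ 2 * levWeight L η lev₁ 2 ((y, κ), κ''))
    (Y : Space115 L η lev₀ lev₁ (nabla115 η (1 : Bond d Pd → 𝔸ˣ))) (hY : ‖Y‖ < 1 / 16) :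
    ‖curV0 (lev₁ := lev₁) (Dc := nabla115 η (1 : Bond d Pd → 𝔸ˣ)) ρ τ 1 Y‖
      ≤ (64 * ((d - 1 : ℕ) : ℝ) * Λ ^ 3 * ‖ρ‖ + ((d - 1 : ℕ) : ℝ) * Λ ^ 3 * (136 + 2 * Λ) * ‖ρ‖ * ‖τ‖) * ‖Y‖ ^ 2 :=
  (quadAnalytic_curV0_flat (lev₀ := lev₀) (lev₁ := lev₁) ρ τ hτ hτs hτ1 hL hΛ1 hΛ hΛa hΛ').quad Y hY

/-- **`‖Y‖ < 1/16 → ‖curV0 ρ τ 1 Y‖₍₋₃₎ ≤ (d − 1)‖ρ‖(64 + 138‖τ‖)·‖Y‖²` AT THE FLAT BACKGROUND, ONE LEVEL** (the `quad` field of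
`quadAnalytic_curV0_flat_oneLevel`). [cite: Balaban1985Variational, (98) p.293, p.302] -/
theorem curV0_flat_oneLevel_quadBound [CompleteSpace 𝔸] [NormOneClass 𝔸] [StarRing 𝔸] [StarModule ℂ 𝔸]
    (ρ : (𝔸 →L[ℂ] ℂ) →L[ℂ] 𝔸) (τ : 𝔸 →L[ℂ] ℂ)
    (hτ : ∀ a b : 𝔸, τ (a * b) = τ (b * a)) (hτs : ∀ a : 𝔸, τ (star a) = starRingEnd ℂ (τ a)) (hτ1 : ∀ X : 𝔸, ‖τ X‖ ≤ ‖X‖) (hL : 1 ≤ L)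
    (j : ℕ) (Y : Space115 L η (fun _ : Bond d Pd => j) (fun _ : Bond d Pd × Fin d => j) (nabla115 η (1 : Bond d Pd → 𝔸ˣ)))
    (hY : ‖Y‖ < 1 / 16) :
    ‖curV0 (lev₁ := fun _ : Bond d Pd × Fin d => j) (Dc := nabla115 η (1 : Bond d Pd → 𝔸ˣ)) ρ τ 1 Y‖
      ≤ (((d - 1 : ℕ) : ℝ) * ‖ρ‖ * (64 + 138 * ‖τ‖)) * ‖Y‖ ^ 2 :=
  (quadAnalytic_curV0_flat_oneLevel ρ τ hτ hτs hτ1 hL j).quad Y hY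

end Literature.MathematicalPhysics.QuantumFieldTheory.Balaban1983to89.B11Eq98V0LettersFlat

end
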